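import Summits.ValiantsHypothesis.ValiantsHypothesis.Theorems.KPlusLogSqLawTropicalSymmetricThreeFourFifteen

/-!
# Route «KPlusLogSqLaw» — the symmetric `(3,4)` tropical row in the ORBIT model — abstract exclusion lemmas, part 1
# (terms of `S₃ × (Fin 3 → Fin 4)` in rank coordinates with the orbit-chain hypotheses of `…TropicalOrbitChainAbstract`)

HONEST FRAMING.  Helper file (seat val-sym-lift-p2 (g6), cell `pub-symmetroid`, 2026-08-27; `--supports` the `WeakLifting` item
stmt-ValiantsHypothesis-19561 as a helper, no closure claim).  A SMALL-FORMAT statement in the transpose-ORBIT carrier model (the cell's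
five-type model: identity terms `D`, cycle-constant transposition terms `T`, pair carriers `C` = fixed-point-free carriers), far inside the
known regime of the cruxes; port blueprint `HOME/val-sym-lift-p2/g6/LEMMA-Z-liftp2g6.md` §6.  Nothing here is about `TropicalB` / `WeakLifting`
in their windows, Conjecture B, DoorA34 = `PosRootLawAt 3 4 18` (OPEN, never asserted), `MatrixDescartes` (stmt-ValiantsHypothesis-18050) or
VP ≠ VNP; the orbit targets `TSymOrb34Le17` / `TSymOrb34Le16` stay targets (NOT asserted).

ABSTRACT HYPOTHESES (the rank-form output of `orbitChain_shape/M/R1/R1'/R3/R3'`, with `g` = exponents by rank, monotone):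
`hshape` (identity / transposition with equal ranks on its pair / fixed-point-free), `hM` (columns reading the same or transposed cells carry
non-decreasing ranks), `hR1`/`hR1'` (identity vs transposition cancellation), `hR3`/`hR3'` (identity vs pair carrier cancellation).
THIS FILE.
* `C_extreme_D`: a pair carrier whose letters contain BOTH the minimal rank `0` and the maximal rank `3` is incompatible with every identity
  term (R3w forbids an identity term before a pair carrier containing `0`; R3′w forbids a pair carrier containing `3` before an identity term);
* `CC_dominated`: two pair carriers along the chain have matched, entrywise non-decreasing letters (same carrier: same cells; inverse
  carriers: transposed cells);
* `orbY1` / `orbY2`: `{0,1,3} = D` and `{1,1,2} = D or T` ⇒ `g 0 + g 3 < 2·g 1`; mirror `{0,2,3} = D`, `{1,2,2} = D or T` ⇒ `2·g 2 < g 0 + g 3`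
  (the single-term Lemma Y of p484117, re-proved under the orbit hypotheses).
[cell statement R1732 «T^orb_sym(3,4) ≤ 17 pre-registered»; folklore-level exchange arguments, no citation exists]
-/

set_option linter.dupNamespace false
set_option autoImplicit false

namespace Summit.ValiantsHypothesis.ValiantsHypothesis.Theorems.KPlusLogSqLaw

open Summit.ValiantsHypothesis.ValiantsHypothesis.Theorems.MatrixDescartes.Negative
open Summit.ValiantsHypothesis.ValiantsHypothesis.Theorems.LacunarySymmetroidMatrixDescartes
open Summit.ValiantsHypothesis.ValiantsHypothesis.Theorems.LacunarySymmetroidMatrixDescartes.TropicalCensus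
open Finset

namespace SymmetricOrbitThreeFour

open SymmetricThreeFour SymmetricThreeFourSeventeen SymmetricThreeFourSixteen SymmetricThreeFourFifteen

/-! ## Carrier bookkeeping in `S₃` -/

/-- cycle data of a fixed-point-free permutation of `Fin 3` from any starting column. -/
theorem cycle_data : ∀ σ : Equiv.Perm (Fin 3), (∀ i, σ i ≠ i) → ∀ i : Fin 3,
    i ≠ σ i ∧ σ (σ i) ≠ i ∧ σ (σ i) ≠ σ i ∧ σ (σ (σ i)) = i := by decide

/-- two fixed-point-free permutations of `Fin 3` are equal or inverse to each other. -/
theorem fpf_eq_or_inv : ∀ σ τ : Equiv.Perm (Fin 3), (∀ i, σ i ≠ i) → (∀ i, τ i ≠ i) → τ = σ ∨ τ = σ⁻¹ := by decide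

/-- a fixed-point-free carrier is not the identity. -/
theorem fpf_ne_one {σ : Equiv.Perm (Fin 3)} (h : ∀ i, σ i ≠ i) : σ ≠ 1 := fun hq => h 0 (by rw [hq]; rfl)

/-- a transposition carrier has a fixed point, so it is not fixed-point-free. -/
theorem swap_not_fpf : ∀ i j : Fin 3, i < j → ¬ (∀ x, Equiv.swap i j x ≠ x) := by decide

/-- `Fin 3` has a third element. -/
theorem exists_third : ∀ i j : Fin 3, ∃ k : Fin 3, k ≠ i ∧ k ≠ j := by decide

/-! ## A pair carrier with both extreme letters excludes identity terms -/

/-- **`C_extreme_D`.**  A fixed-point-free term carrying rank `0` at some column and rank `3` at some column cannot coexist with an identity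
term in the chain. [R3w / R3′w with the extreme letter] -/
theorem C_extreme_D {n : ℕ} (r : Fin (n + 1) → Equiv.Perm (Fin 3) × (Fin 3 → Fin 4)) (g : Fin 4 → ℕ) (hmono : Monotone g)
    (hR3 : ∀ a b : Fin (n + 1), a < b → (r a).1 = 1 → ∀ i j k : Fin 3, i ≠ j → k ≠ i → k ≠ j →
      (r b).1 i = j → (r b).1 j = k → (r b).1 k = i → g ((r a).2 i) + g ((r a).2 j) < 2 * g ((r b).2 i))
    (hR3' : ∀ a b : Fin (n + 1), a < b → (r b).1 = 1 → ∀ i j k : Fin 3, i ≠ j → k ≠ i → k ≠ j →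
      (r a).1 i = j → (r a).1 j = k → (r a).1 k = i → 2 * g ((r a).2 i) < g ((r b).2 i) + g ((r b).2 j))
    (x z : Fin (n + 1)) (hx1 : (r x).1 = 1) (hz : ∀ i, (r z).1 i ≠ i)
    (l0 l3 : Fin 3) (h0 : (r z).2 l0 = 0) (h3 : (r z).2 l3 = 3) : False := by
  have hxz : x ≠ z := by
    intro hq; rw [hq] at hx1; exact fpf_ne_one hz hx1
  have gle : ∀ y : Fin 4, g 0 ≤ g y ∧ g y ≤ g 3 := fun y => ⟨hmono (Fin.zero_le _), hmono (Fin.le_last _)⟩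
  rcases lt_or_gt_of_ne hxz with hlt | hlt
  · -- D before C: cancellation at the pair read with the letter `0`
    obtain ⟨h1, h2, h3', h4⟩ := cycle_data (r z).1 hz l0
    have hC := hR3 x z hlt hx1 l0 ((r z).1 l0) ((r z).1 ((r z).1 l0)) h1 h2 h3' rfl rfl h4
    rw [h0] at hC
    have := (gle ((r x).2 l0)).1
    have := (gle ((r x).2 ((r z).1 l0))).1
    omega
  · -- C before D: cancellation at the pair read with the letter `3`
    obtain ⟨h1, h2, h3', h4⟩ := cycle_data (r z).1 hz l3
    have hC := hR3' z x hlt hx1 l3 ((r z).1 l3) ((r z).1 ((r z).1 l3)) h1 h2 h3' rfl rfl h4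
    rw [h3] at hC
    have := (gle ((r x).2 l3)).2
    have := (gle ((r x).2 ((r z).1 l3))).2
    omega

/-! ## Two pair carriers along the chain -/

/-- **`CC_dominated`.**  Two fixed-point-free terms at positions `a < b` have matched letters: every letter of the earlier one is `≤` some
letter of the later one at the matched column, and conversely (same carrier: the same cells; inverse carriers: transposed cells). [hM] -/
theorem CC_dominated {n : ℕ} (r : Fin (n + 1) → Equiv.Perm (Fin 3) × (Fin 3 → Fin 4))
    (hM : ∀ a b : Fin (n + 1), a < b → ∀ l₁ l₂ : Fin 3,
      ((r a).1 l₁ = (r b).1 l₂ ∧ l₁ = l₂) ∨ ((r a).1 l₁ = l₂ ∧ (r b).1 l₂ = l₁) → (r a).2 l₁ ≤ (r b).2 l₂)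
    (a b : Fin (n + 1)) (hab : a < b) (ha : ∀ i, (r a).1 i ≠ i) (hb : ∀ i, (r b).1 i ≠ i) :
    ∃ φ : Equiv.Perm (Fin 3), ∀ l, (r a).2 l ≤ (r b).2 (φ l) := by
  rcases fpf_eq_or_inv (r a).1 (r b).1 ha hb with h | h
  · exact ⟨1, fun l => hM a b hab l l (Or.inl ⟨by rw [h], rfl⟩)⟩
  · refine ⟨(r a).1, fun l => hM a b hab l ((r a).1 l) (Or.inr ⟨rfl, ?_⟩)⟩
    rw [h]; simp

/-! ## The single-term Lemma Y under the orbit hypotheses -/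

/-- **`orbY1`**: `{0,1,3}` carried by an identity term and `{1,1,2}` carried by an identity or transposition term ⇒ `g 0 + g 3 < 2·g 1`.
[single-entry + crossing exchange; p484117's lemmaY1 in the orbit framework] -/
theorem orbY1 {n : ℕ} (r : Fin (n + 1) → Equiv.Perm (Fin 3) × (Fin 3 → Fin 4)) (g : Fin 4 → ℕ) (hmono : Monotone g)
    (hM : ∀ a b : Fin (n + 1), a < b → ∀ l₁ l₂ : Fin 3,
      ((r a).1 l₁ = (r b).1 l₂ ∧ l₁ = l₂) ∨ ((r a).1 l₁ = l₂ ∧ (r b).1 l₂ = l₁) → (r a).2 l₁ ≤ (r b).2 l₂)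
    (hR1 : ∀ a b : Fin (n + 1), a < b → (r a).1 = 1 → ∀ i j : Fin 3, i ≠ j → (r b).1 = Equiv.swap i j → (r b).2 i = (r b).2 j →
      g ((r a).2 i) + g ((r a).2 j) < 2 * g ((r b).2 i))
    (hR1' : ∀ a b : Fin (n + 1), a < b → (r b).1 = 1 → ∀ i j : Fin 3, i ≠ j → (r a).1 = Equiv.swap i j → (r a).2 i = (r a).2 j →
      2 * g ((r a).2 i) < g ((r b).2 i) + g ((r b).2 j))
    (a c : Fin (n + 1)) (ha1 : (r a).1 = 1)
    (ha : TropicalCensus.classSym (r a) = TropicalCensus.classSym ((1 : Equiv.Perm (Fin 3)), (![0, 1, 3] : Fin 3 → Fin 4)))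
    (hc : TropicalCensus.classSym (r c) = TropicalCensus.classSym ((1 : Equiv.Perm (Fin 3)), (![1, 1, 2] : Fin 3 → Fin 4)))
    (hcshape : (r c).1 = 1 ∨ ∃ i j : Fin 3, i < j ∧ (r c).1 = Equiv.swap i j ∧ (r c).2 i = (r c).2 j) : g 0 + g 3 < 2 * g 1 := by
  have ca : ∀ l, (univ.filter fun i => (r a).2 i = l).card = (![1, 1, 0, 1] : Fin 4 → ℕ) l :=
    fun l => (card_filter_eq_of_classSym_eq ha l).trans (cnt013 l)
  have cc : ∀ l, (univ.filter fun i => (r c).2 i = l).card = (![0, 2, 1, 0] : Fin 4 → ℕ) l :=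
    fun l => (card_filter_eq_of_classSym_eq hc l).trans (cnt112 l)
  have hac : a ≠ c := by
    intro h; have := ca 0; rw [h, cc 0] at this; exact absurd this (by decide)
  have ua2 : ∀ i, (r a).2 i ≠ 2 := ne_of_card_zero _ 2 (by rw [ca 2]; rfl)
  have wc0 : ∀ i, (r c).2 i ≠ 0 := ne_of_card_zero _ 0 (by rw [cc 0]; rfl)
  have wc3 : ∀ i, (r c).2 i ≠ 3 := ne_of_card_zero _ 3 (by rw [cc 3]; rfl)
  have g01 : g 0 ≤ g 1 := hmono (by decide)
  have g12 : g 1 ≤ g 2 := hmono (by decide)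
  have g23 : g 2 ≤ g 3 := hmono (by decide)
  -- same-cell monotonicity for two identity carriers / at the fixed column of a transposition
  have hMD : ∀ x y : Fin (n + 1), x < y → ∀ l, (r x).1 l = (r y).1 l → (r x).2 l ≤ (r y).2 l :=
    fun x y hxy l hl => hM x y hxy l l (Or.inl ⟨hl, rfl⟩)
  rcases hcshape with hc1 | ⟨i, j, hij, hswap, hcc⟩
  · exfalso
    rcases lt_or_gt_of_ne hac with hlt | hlt
    · obtain ⟨k, hk⟩ := exists_of_card_pos _ 3 (by rw [ca 3]; decide)
      have hle := hMD a c hlt k (by rw [ha1, hc1])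
      rw [hk] at hle
      exact wc3 k (le_antisymm (Fin.le_last _) hle)
    · obtain ⟨k, hk⟩ := exists_of_card_pos _ 0 (by rw [ca 0]; decide)
      have hle := hMD c a hlt k (by rw [ha1, hc1])
      rw [hk] at hle
      exact wc0 k (le_antisymm hle (Fin.zero_le _))
  · -- `c` is the transposition `swap i j` with pair rank `1` and fixed rank `2` at the third column `k`
    have hij' : i ≠ j := ne_of_lt hij
    obtain ⟨k, hki, hkj⟩ := exists_third i j
    have hpair1 : (r c).2 i = 1 := by
      -- the repeated class of `{1,1,2}` is `1`
      by_contra hne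
      have h2 : (r c).2 i = 2 := f4_j _ (wc0 i) hne (wc3 i)
      have h2le := two_le_card_filter (r c) hij'.symm hcc.symm
      rw [h2, cc 2] at h2le
      exact absurd h2le (by decide)
    have hk2 : (r c).2 k = 2 := by
      have hk1 : (r c).2 k ≠ 1 := by
        intro hk1
        -- three entries of class 1
        have hsub : ({i, j, k} : Finset (Fin 3)) ⊆ univ.filter fun x => (r c).2 x = 1 := by
          intro x hx
          simp only [mem_insert, mem_singleton] at hx
          rw [mem_filter]
          rcases hx with rfl | rfl | rfl
          · exact ⟨mem_univ _, hpair1⟩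
          · exact ⟨mem_univ _, hcc ▸ hpair1⟩
          · exact ⟨mem_univ _, hk1⟩
        have := card_le_card hsub
        rw [card_insert_of_notMem (by simp [hij', hki.symm]), card_pair hkj.symm, cc 1] at this
        exact absurd this (by decide)
      exact f4_j _ (wc0 k) hk1 (wc3 k)
    have hck : (r c).1 k = k := by rw [hswap, Equiv.swap_apply_of_ne_of_ne hki hkj]
    rcases lt_or_gt_of_ne hac with hlt | hlt
    · -- D before T: `u k ≤ 2` so `u k ∈ {0,1}`; cancellation `g(u i) + g(u j) < 2 g 1`
      have hle := hMD a c hlt k (by rw [ha1, hck, Equiv.Perm.one_apply])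
      rw [hk2] at hle
      have hC := hR1 a c hlt ha1 i j hij' hswap hcc
      rw [hpair1] at hC
      rcases f4_a _ (ua2 k) hle with hk0 | hk1
      · exfalso
        have hi0 : (r a).2 i ≠ 0 := ne_of_card_one _ 0 (by rw [ca 0]; rfl) hk0 hki.symm
        have hj0 : (r a).2 j ≠ 0 := ne_of_card_one _ 0 (by rw [ca 0]; rfl) hk0 hkj.symm
        have gi : g 1 ≤ g ((r a).2 i) := hmono (f4_b _ hi0)
        have gj : g 1 ≤ g ((r a).2 j) := hmono (f4_b _ hj0)
        omega
      · have hi1 : (r a).2 i ≠ 1 := ne_of_card_one _ 1 (by rw [ca 1]; rfl) hk1 hki.symm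
        have hj1 : (r a).2 j ≠ 1 := ne_of_card_one _ 1 (by rw [ca 1]; rfl) hk1 hkj.symm
        have hij2 : (r a).2 i ≠ (r a).2 j := by
          intro h
          have h2le := two_le_card_filter (r a) hij'.symm h.symm
          rcases f4_c _ hi1 (ua2 i) with hi0 | hi3
          · rw [hi0, ca 0] at h2le; exact absurd h2le (by decide)
          · rw [hi3, ca 3] at h2le; exact absurd h2le (by decide)
        rcases f4_c _ hi1 (ua2 i) with hi0 | hi3 <;> rcases f4_c _ hj1 (ua2 j) with hj0 | hj3
        · exact absurd (hi0.trans hj0.symm) hij2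
        · rw [hi0, hj3] at hC; omega
        · rw [hi3, hj0] at hC; omega
        · exact absurd (hi3.trans hj3.symm) hij2
    · -- T before D: `2 ≤ u k` forces `u k = 3`; cancellation `2 g 1 < g(u i) + g(u j)` with `u i, u j ≤ 1`
      exfalso
      have hle := hMD c a hlt k (by rw [ha1, hck, Equiv.Perm.one_apply])
      rw [hk2] at hle
      have hk3 : (r a).2 k = 3 := f4_d _ hle (ua2 k)
      have hC := hR1' c a hlt ha1 i j hij' hswap hcc
      rw [hpair1] at hC
      have hi3 : (r a).2 i ≠ 3 := ne_of_card_one _ 3 (by rw [ca 3]; rfl) hk3 hki.symm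
      have hj3 : (r a).2 j ≠ 3 := ne_of_card_one _ 3 (by rw [ca 3]; rfl) hk3 hkj.symm
      have gi : g ((r a).2 i) ≤ g 1 := hmono (f4_e _ hi3 (ua2 i))
      have gj : g ((r a).2 j) ≤ g 1 := hmono (f4_e _ hj3 (ua2 j))
      omega

/-- **`orbY2`** (mirror): `{0,2,3}` carried by an identity term and `{1,2,2}` carried by an identity or transposition term ⇒
`2·g 2 < g 0 + g 3`. [single-entry + crossing exchange; p484117's lemmaY2 in the orbit framework] -/
theorem orbY2 {n : ℕ} (r : Fin (n + 1) → Equiv.Perm (Fin 3) × (Fin 3 → Fin 4)) (g : Fin 4 → ℕ) (hmono : Monotone g)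
    (hM : ∀ a b : Fin (n + 1), a < b → ∀ l₁ l₂ : Fin 3,
      ((r a).1 l₁ = (r b).1 l₂ ∧ l₁ = l₂) ∨ ((r a).1 l₁ = l₂ ∧ (r b).1 l₂ = l₁) → (r a).2 l₁ ≤ (r b).2 l₂)
    (hR1 : ∀ a b : Fin (n + 1), a < b → (r a).1 = 1 → ∀ i j : Fin 3, i ≠ j → (r b).1 = Equiv.swap i j → (r b).2 i = (r b).2 j →
      g ((r a).2 i) + g ((r a).2 j) < 2 * g ((r b).2 i))
    (hR1' : ∀ a b : Fin (n + 1), a < b → (r b).1 = 1 → ∀ i j : Fin 3, i ≠ j → (r a).1 = Equiv.swap i j → (r a).2 i = (r a).2 j →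
      2 * g ((r a).2 i) < g ((r b).2 i) + g ((r b).2 j))
    (a c : Fin (n + 1)) (ha1 : (r a).1 = 1)
    (ha : TropicalCensus.classSym (r a) = TropicalCensus.classSym ((1 : Equiv.Perm (Fin 3)), (![0, 2, 3] : Fin 3 → Fin 4)))
    (hc : TropicalCensus.classSym (r c) = TropicalCensus.classSym ((1 : Equiv.Perm (Fin 3)), (![1, 2, 2] : Fin 3 → Fin 4)))
    (hcshape : (r c).1 = 1 ∨ ∃ i j : Fin 3, i < j ∧ (r c).1 = Equiv.swap i j ∧ (r c).2 i = (r c).2 j) : 2 * g 2 < g 0 + g 3 := by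
  have ca : ∀ l, (univ.filter fun i => (r a).2 i = l).card = (![1, 0, 1, 1] : Fin 4 → ℕ) l :=
    fun l => (card_filter_eq_of_classSym_eq ha l).trans (cnt023 l)
  have cc : ∀ l, (univ.filter fun i => (r c).2 i = l).card = (![0, 1, 2, 0] : Fin 4 → ℕ) l :=
    fun l => (card_filter_eq_of_classSym_eq hc l).trans (cnt122 l)
  have hac : a ≠ c := by
    intro h; have := ca 0; rw [h, cc 0] at this; exact absurd this (by decide)
  have ua1 : ∀ i, (r a).2 i ≠ 1 := ne_of_card_zero _ 1 (by rw [ca 1]; rfl)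
  have wc0 : ∀ i, (r c).2 i ≠ 0 := ne_of_card_zero _ 0 (by rw [cc 0]; rfl)
  have wc3 : ∀ i, (r c).2 i ≠ 3 := ne_of_card_zero _ 3 (by rw [cc 3]; rfl)
  have hMD : ∀ x y : Fin (n + 1), x < y → ∀ l, (r x).1 l = (r y).1 l → (r x).2 l ≤ (r y).2 l :=
    fun x y hxy l hl => hM x y hxy l l (Or.inl ⟨hl, rfl⟩)
  rcases hcshape with hc1 | ⟨i, j, hij, hswap, hcc⟩
  · exfalso
    rcases lt_or_gt_of_ne hac with hlt | hlt
    · obtain ⟨k, hk⟩ := exists_of_card_pos _ 3 (by rw [ca 3]; decide)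
      have hle := hMD a c hlt k (by rw [ha1, hc1])
      rw [hk] at hle
      exact wc3 k (le_antisymm (Fin.le_last _) hle)
    · obtain ⟨k, hk⟩ := exists_of_card_pos _ 0 (by rw [ca 0]; decide)
      have hle := hMD c a hlt k (by rw [ha1, hc1])
      rw [hk] at hle
      exact wc0 k (le_antisymm hle (Fin.zero_le _))
  · -- `c` is the transposition `swap i j` with pair rank `2` and fixed rank `1` at the third column `k`
    have hij' : i ≠ j := ne_of_lt hij
    obtain ⟨k, hki, hkj⟩ := exists_third i j
    have hpair2 : (r c).2 i = 2 := by
      by_contra hne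
      have h1 : (r c).2 i = 1 := f4_k _ (wc0 i) hne (wc3 i)
      have h2le := two_le_card_filter (r c) hij'.symm hcc.symm
      rw [h1, cc 1] at h2le
      exact absurd h2le (by decide)
    have hk1 : (r c).2 k = 1 := by
      have hk2 : (r c).2 k ≠ 2 := by
        intro hk2
        have hsub : ({i, j, k} : Finset (Fin 3)) ⊆ univ.filter fun x => (r c).2 x = 2 := by
          intro x hx
          simp only [mem_insert, mem_singleton] at hx
          rw [mem_filter]
          rcases hx with rfl | rfl | rfl
          · exact ⟨mem_univ _, hpair2⟩
          · exact ⟨mem_univ _, hcc ▸ hpair2⟩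
          · exact ⟨mem_univ _, hk2⟩
        have := card_le_card hsub
        rw [card_insert_of_notMem (by simp [hij', hki.symm]), card_pair hkj.symm, cc 2] at this
        exact absurd this (by decide)
      exact f4_k _ (wc0 k) hk2 (wc3 k)
    have hck : (r c).1 k = k := by rw [hswap, Equiv.swap_apply_of_ne_of_ne hki hkj]
    rcases lt_or_gt_of_ne hac with hlt | hlt
    · -- D before T: `u k ≤ 1` forces `u k = 0`; then `u i, u j ≥ 2` and the cancellation is absurd
      exfalso
      have hle := hMD a c hlt k (by rw [ha1, hck, Equiv.Perm.one_apply])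
      rw [hk1] at hle
      have hk0 : (r a).2 k = 0 := f4_f _ hle (ua1 k)
      have hC := hR1 a c hlt ha1 i j hij' hswap hcc
      rw [hpair2] at hC
      have hi0 : (r a).2 i ≠ 0 := ne_of_card_one _ 0 (by rw [ca 0]; rfl) hk0 hki.symm
      have hj0 : (r a).2 j ≠ 0 := ne_of_card_one _ 0 (by rw [ca 0]; rfl) hk0 hkj.symm
      have gi : g 2 ≤ g ((r a).2 i) := hmono (f4_g _ hi0 (ua1 i))
      have gj : g 2 ≤ g ((r a).2 j) := hmono (f4_g _ hj0 (ua1 j))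
      omega
    · -- T before D: `1 ≤ u k`, so `u k ∈ {2, 3}`
      have hle := hMD c a hlt k (by rw [ha1, hck, Equiv.Perm.one_apply])
      rw [hk1] at hle
      have hC := hR1' c a hlt ha1 i j hij' hswap hcc
      rw [hpair2] at hC
      rcases f4_h _ hle (ua1 k) with hk2 | hk3
      · have hi2 : (r a).2 i ≠ 2 := ne_of_card_one _ 2 (by rw [ca 2]; rfl) hk2 hki.symm
        have hj2 : (r a).2 j ≠ 2 := ne_of_card_one _ 2 (by rw [ca 2]; rfl) hk2 hkj.symm
        have hij2 : (r a).2 i ≠ (r a).2 j := by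
          intro h
          have h2le := two_le_card_filter (r a) hij'.symm h.symm
          rcases f4_c _ (ua1 i) hi2 with hi0 | hi3
          · rw [hi0, ca 0] at h2le; exact absurd h2le (by decide)
          · rw [hi3, ca 3] at h2le; exact absurd h2le (by decide)
        rcases f4_c _ (ua1 i) hi2 with hi0 | hi3 <;> rcases f4_c _ (ua1 j) hj2 with hj0 | hj3
        · exact absurd (hi0.trans hj0.symm) hij2
        · rw [hi0, hj3] at hC; omega
        · rw [hi3, hj0] at hC; omega
        · exact absurd (hi3.trans hj3.symm) hij2
      · exfalso
        have hi3 : (r a).2 i ≠ 3 := ne_of_card_one _ 3 (by rw [ca 3]; rfl) hk3 hki.symm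
        have hj3 : (r a).2 j ≠ 3 := ne_of_card_one _ 3 (by rw [ca 3]; rfl) hk3 hkj.symm
        have gi : g ((r a).2 i) ≤ g 2 := hmono (f4_i _ hi3)
        have gj : g ((r a).2 j) ≤ g 2 := hmono (f4_i _ hj3)
        omega

end SymmetricOrbitThreeFour

end Summit.ValiantsHypothesis.ValiantsHypothesis.Theorems.KPlusLogSqLaw
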